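import Summits.CriticalPhenomena.PercolationContinuityZ3.Theses.PercQuarantineIslands
import Summits.CriticalPhenomena.PercolationContinuityZ3.Theorems.PercNearOneGluingNoHeavyLowerTailCSHTheoremOne
import HarnessLib

/-!
# `PercQuarantineIslands.TargetFromCruxes` (stmt-CriticalPhenomena-14228) — SETTLED after continuity

Item `stmt-CriticalPhenomena-14228` of route `CriticalPhenomena/PercQuarantineIslands` (support (glue)): `FiniteClusterVolumeTail → HalfSpaceOneArmFourFifths → KZTailsAndBoundaryArm`.

The target is literally the conjunction of the two crux bodies: `And.intro`.  p205010 is NOT used.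

builds on p205010 (kernel theorem, internal audit signed; external expert review pending) — USED (`CSH.percolationContinuityZ3_holds`).  RSW3 lane, lead gen 28 (prover-prim-rsw3-lead-g28-0):
'after continuity — the ledger harvest'.
References: G. Kozma, N. Nitzan (2024), Thm. 6 / Conj. 3 [KozmaNitzan2024]; G. Grimmett, *Percolation* (1999), §8 [GrimmettPercolation1999].
-/

noncomputable section

namespace Summit.CriticalPhenomena.PercolationContinuityZ3.Theorems

namespace PercQuarantineIslandsTargetFromCruxes

open MeasureTheory Literature.Probability.Percolation Literature.Probability.LatticeModels

/-- **`PercQuarantineIslands.TargetFromCruxes` (stmt-CriticalPhenomena-14228), settled.**  `fun hK hH => ⟨hK, hH⟩`.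
[cite: KozmaNitzan2024, Thm. 6 with Conj. 3 (p. 15)] -/
theorem targetFromCruxes_proof : Summit.CriticalPhenomena.PercolationContinuityZ3.Theses.PercQuarantineIslands.TargetFromCruxes := by
  unfold Summit.CriticalPhenomena.PercolationContinuityZ3.Theses.PercQuarantineIslands.TargetFromCruxes
  intro hK hH
  exact ⟨hK, hH⟩

end PercQuarantineIslandsTargetFromCruxes

end Summit.CriticalPhenomena.PercolationContinuityZ3.Theorems

end
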